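/-
Copyright (c) 2026. All rights reserved.
Released under Apache 2.0 license as described in the file LICENSE.
-/
import Literature.NumberTheory.Automorphic.MaximalOrderDiscThirteenBrandtSetup
import Literature.NumberTheory.Automorphic.MaximalOrderDiscThirteenNormsSmall
import HarnessLib

/-!
# The Brandt matrices of `O₁₃ ⊂ (−2,−13 ∣ ℚ)` at the first prime powers of the split primes `2, 3`: `T(2) = 3`, `T(4) = 7`,
# `T(8) = 15`, `T(16) = 31`, `T(3) = 4`, `T(9) = 13` (`= σ`), `T(5) = 6`, `T(7) = 8`, `T(6) = 12`, and Eichler's recursion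
# `B(p)B(p^ν) = B(p^(ν+1)) + p·B(p^(ν−1))` in these instances — for every Brandt setup of type `(1, 13)`

[tag: quaternion_algebra] [tag: brandt_matrix] [tag: hecke_operator]

Topic `NumberTheory/Automorphic`; THEOREMS ONLY (no definition, no named fact, no instance; net Literature debt `0`).
Lane `lit-hodgefound`, seat p12, gen 46 — a file of the series on the definite quaternion order of discriminant `13`, the `D = 13`
counterpart of §1′ of `MaximalOrderDiscFiveBrandtSetup` ∕ `MaximalOrderDiscSevenHeckeSmall`. `MaximalOrderDiscThirteenBrandtSetup` gave,
for the one-class maximal order `O₁₃`, `#{x ∈ O₁₃ : nrd x = n} = 2·T(n)` and the closed form `T(13ᵃm) = σ(m)` for squarefree `m`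
prime to `13`; `MaximalOrderDiscThirteenNormsSmall` certified `r₁₃(4) = 14`, `r₁₃(8) = 30`, `r₁₃(9) = 26`, `r₁₃(16) = 62` by enumeration.
Dividing by `2w = 2` gives the first NON-squarefree Brandt matrices, and with them the instances `ν ≤ 3` at `p = 2` and `ν = 1`
at `p = 3` of EICHLER'S RECURSION (LNM 320 II §6 Thm. 2 (19): `B(p^μ)B(p^ν) = Σ_σ p^σ B(p^(μ+ν−2σ))` for `p ∤ D`), i.e. of the
Hecke relation `T(p)T(p^ν) = T(p^(ν+1)) + p T(p^(ν−1))`, hence `T(pᵃ) = σ(pᵃ)` for `pᵃ ∈ {4, 8, 16, 9}` as Eichler's Cor. 1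
(row sums `Σ_{d ∣ n, 13 ∤ d} d`) predicts:

* §1 (at `O₁₃`) `matrix_two` (`3`), `matrix_three` (`4`), `matrix_five` (`6`), `matrix_seven` (`8`), `matrix_six` (`12`), **`matrix_four`** (`7`),
  **`matrix_eight`** (`15`), **`matrix_nine`** (`13`), **`matrix_sixteen`** (`31`); **`matrix_two_mul_matrix_two`**
  (`B(2)² = B(4) + 2`), **`matrix_two_mul_matrix_four`** (`B(2)B(4) = B(8) + 2B(2)`), **`matrix_two_mul_matrix_eight`**
  (`B(2)B(8) = B(16) + 2B(4)`), **`matrix_three_mul_matrix_three`** (`B(3)² = B(9) + 3`), `matrix_prime_pow_eq_sigma_small`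
  (`T(2ᵃ) = σ(2ᵃ)`, `a ≤ 4`; `T(3ᵃ) = σ(3ᵃ)`, `a ≤ 2`);
* §2 (every `S : XiSetup 1 13`, transported as in `MaximalOrderDiscThirteenBrandtSetup` along
  `exists_classSetEquiv_map_ringEquiv` and `exists_classSetEquiv_leftOrder`) `xiSetup_matrix_four`, `xiSetup_matrix_eight`, `xiSetup_matrix_nine`,
  `xiSetup_matrix_sixteen`, **`xiSetup_matrix_two_mul_matrix_two`**, **`xiSetup_matrix_three_mul_matrix_three`**.

## Sources

* M. Eichler, LNM 320 (1973), Ch. II §6 (16), Thm. 2 (18)–(19) and Cor. 1. [cite: Eichler1973, Ch. II §6 (16), Thm. 2 (18)–(19) and Cor. 1]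
* J. Voight, *Quaternion Algebras*, GTM 288 (2021), Prop. 41.2.12 ∕ (41.2.13) (the Brandt matrices commute and satisfy
  `T(p)T(p^r) = T(p^(r+1)) + p T(p^(r−1))` for `p ∤ N`), Exercise 17.10, Thm. 25.4.1 (`D = 13`). [cite: Voight2021, Prop. 41.2.12; Exercise 17.10; Thm. 25.4.1 (D = 13)]
* A. Pizer, *An algorithm for computing modular forms on Γ₀(N)*, J. Algebra 64 (1980), §2 (Thm. 2.7: the Brandt matrices
  generate a commutative algebra with the Hecke relations). [cite: Pizer1980, §2 Thm. 2.7]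

## Scope (honest)

Theorems only. Finitely many instances (`pᵃ ∈ {4, 8, 16, 9}`) from certified counts; the recursion for all `ν` and all `p ≠ 13`
is the tree's `BrandtHeckeFamily`, not used here.
-/

open Quaternion
open Finset
open scoped Pointwise
open Literature.NumberTheory.Automorphic.Brandt

namespace Literature.NumberTheory.Automorphic.MaxOrderDiscThirteen

/-- `13` is prime. [folklore] -/
private theorem prime_thirteen : Nat.Prime 13 := by decide

/-! ## §1 At `O₁₃`: `T(4) = 7`, `T(8) = 15`, `T(9) = 13`, `T(16) = 31`, Eichler's recursion at `2, 3` -/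

section Hecke

/-- The class set of `O₁₃` is finite (a point). [folklore] -/
private theorem finite_classSet_O₁₃ : Finite (ClassSet (Submodule.span ℤ (Set.range ![(⟨1, 0, 0, 0⟩ : ℍ[ℚ,-2,-13]), ⟨0, 1, 0, 0⟩, ⟨1/2, 1/2, 1/2, 0⟩, ⟨-1/2, 1/4, 0, 1/4⟩]))) :=
  haveI := isQuaternionAlgebra
  Brandt.finite_classSet ℚ isOrder_lattice

/-- Products of `1 × 1` matrices, entrywise. [folklore] -/
private theorem mul_apply_pt [Fintype (ClassSet (Submodule.span ℤ (Set.range ![(⟨1, 0, 0, 0⟩ : ℍ[ℚ,-2,-13]), ⟨0, 1, 0, 0⟩, ⟨1/2, 1/2, 1/2, 0⟩, ⟨-1/2, 1/4, 0, 1/4⟩])))] (A C : Matrix (ClassSet (Submodule.span ℤ (Set.range ![(⟨1, 0, 0, 0⟩ : ℍ[ℚ,-2,-13]), ⟨0, 1, 0, 0⟩, ⟨1/2, 1/2, 1/2, 0⟩, ⟨-1/2, 1/4, 0, 1/4⟩]))) (ClassSet (Submodule.span ℤ (Set.range ![(⟨1, 0, 0, 0⟩ : ℍ[ℚ,-2,-13]),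 ⟨0, 1, 0, 0⟩, ⟨1/2, 1/2, 1/2, 0⟩, ⟨-1/2, 1/4, 0, 1/4⟩]))) ℤ) (i j : ClassSet (Submodule.span ℤ (Set.range ![(⟨1, 0, 0, 0⟩ : ℍ[ℚ,-2,-13]), ⟨0, 1, 0, 0⟩, ⟨1/2, 1/2, 1/2, 0⟩, ⟨-1/2, 1/4, 0, 1/4⟩]))) :
    (A * C) i j = A i j * C i j := by
  haveI := subsingleton_classSet
  rw [Matrix.mul_apply, Fintype.sum_subsingleton _ i, Subsingleton.elim j i]

/-- `T(n)_ij` from `r₁₃(n) = 2·T(n)_ii` on the one-point class set. [cite: Eichler1973, Ch. II §6 Thm. 2 Cor. 1] -/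
private theorem matrix_apply_of_natCard_form {n : ℕ} (hn : n ≠ 0) {s : ℕ}
    (hs : Nat.card {v : ℤ × ℤ × ℤ × ℤ // v.1 ^ 2 + 2 * v.2.1 ^ 2 + 4 * v.2.2.1 ^ 2 + 2 * v.2.2.2 ^ 2 + v.1 * v.2.2.1 - v.1 * v.2.2.2 +
          2 * v.2.1 * v.2.2.1 + v.2.1 * v.2.2.2 = n} = s)
    (i j : ClassSet (Submodule.span ℤ (Set.range ![(⟨1, 0, 0, 0⟩ : ℍ[ℚ,-2,-13]), ⟨0, 1, 0, 0⟩, ⟨1/2, 1/2, 1/2, 0⟩, ⟨-1/2, 1/4, 0, 1/4⟩]))) : 2 * matrix (Submodule.span ℤ (Set.range ![(⟨1, 0, 0, 0⟩ : ℍ[ℚ,-2,-13]), ⟨0, 1, 0, 0⟩, ⟨1/2, 1/2, 1/2, 0⟩, ⟨-1/2, 1/4, 0, 1/4⟩])) n i j = s := by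
  haveI := subsingleton_classSet
  rw [Subsingleton.elim j i]
  have h := natCard_reducedNorm_eq_two_mul_matrix hn i
  rw [← natCard_form_eq_natCard_reducedNorm, hs] at h
  exact_mod_cast h.symm

/-- `T(2)_ij = 3`. [cite: Eichler1973, Ch. II §6 (16)] -/
theorem matrix_two (i j : ClassSet (Submodule.span ℤ (Set.range ![(⟨1, 0, 0, 0⟩ : ℍ[ℚ,-2,-13]), ⟨0, 1, 0, 0⟩, ⟨1/2, 1/2, 1/2, 0⟩, ⟨-1/2, 1/4, 0, 1/4⟩]))) : matrix (Submodule.span ℤ (Set.range ![(⟨1, 0, 0, 0⟩ : ℍ[ℚ,-2,-13]), ⟨0, 1, 0, 0⟩, ⟨1/2, 1/2, 1/2, 0⟩, ⟨-1/2, 1/4, 0, 1/4⟩])) 2 i j = 3 := by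
  rw [matrix_prime Nat.prime_two (by norm_num) i j]
  norm_num

/-- `T(3)_ij = 4`. [cite: Eichler1973, Ch. II §6 (16)] -/
theorem matrix_three (i j : ClassSet (Submodule.span ℤ (Set.range ![(⟨1, 0, 0, 0⟩ : ℍ[ℚ,-2,-13]), ⟨0, 1, 0, 0⟩, ⟨1/2, 1/2, 1/2, 0⟩, ⟨-1/2, 1/4, 0, 1/4⟩]))) : matrix (Submodule.span ℤ (Set.range ![(⟨1, 0, 0, 0⟩ : ℍ[ℚ,-2,-13]), ⟨0, 1, 0, 0⟩, ⟨1/2, 1/2, 1/2, 0⟩, ⟨-1/2, 1/4, 0, 1/4⟩])) 3 i j = 4 := by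
  rw [matrix_prime Nat.prime_three (by norm_num) i j]
  norm_num

/-- `T(5)_ij = 6`. [cite: Eichler1973, Ch. II §6 (16)] -/
theorem matrix_five (i j : ClassSet (Submodule.span ℤ (Set.range ![(⟨1, 0, 0, 0⟩ : ℍ[ℚ,-2,-13]), ⟨0, 1, 0, 0⟩, ⟨1/2, 1/2, 1/2, 0⟩, ⟨-1/2, 1/4, 0, 1/4⟩]))) : matrix (Submodule.span ℤ (Set.range ![(⟨1, 0, 0, 0⟩ : ℍ[ℚ,-2,-13]), ⟨0, 1, 0, 0⟩, ⟨1/2, 1/2, 1/2, 0⟩, ⟨-1/2, 1/4, 0, 1/4⟩])) 5 i j = 6 := by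
  rw [matrix_prime Nat.prime_five (by norm_num) i j]
  norm_num

/-- `T(7)_ij = 8` (`7` is split for `(−2,−13 ∣ ℚ)`). [cite: Eichler1973, Ch. II §6 (16)] -/
theorem matrix_seven (i j : ClassSet (Submodule.span ℤ (Set.range ![(⟨1, 0, 0, 0⟩ : ℍ[ℚ,-2,-13]), ⟨0, 1, 0, 0⟩, ⟨1/2, 1/2, 1/2, 0⟩, ⟨-1/2, 1/4, 0, 1/4⟩]))) : matrix (Submodule.span ℤ (Set.range ![(⟨1, 0, 0, 0⟩ : ℍ[ℚ,-2,-13]), ⟨0, 1, 0, 0⟩, ⟨1/2, 1/2, 1/2, 0⟩, ⟨-1/2, 1/4, 0, 1/4⟩])) 7 i j = 8 := by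
  rw [matrix_prime (by norm_num) (by norm_num) i j]
  norm_num

/-- `T(6)_ij = 12` (`= T(2)T(3)`). [cite: Eichler1973, Ch. II §6 Thm. 2 (18)] -/
theorem matrix_six (i j : ClassSet (Submodule.span ℤ (Set.range ![(⟨1, 0, 0, 0⟩ : ℍ[ℚ,-2,-13]), ⟨0, 1, 0, 0⟩, ⟨1/2, 1/2, 1/2, 0⟩, ⟨-1/2, 1/4, 0, 1/4⟩]))) : matrix (Submodule.span ℤ (Set.range ![(⟨1, 0, 0, 0⟩ : ℍ[ℚ,-2,-13]), ⟨0, 1, 0, 0⟩, ⟨1/2, 1/2, 1/2, 0⟩, ⟨-1/2, 1/4, 0, 1/4⟩])) 6 i j = 12 := by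
  rw [show (6 : ℕ) = 2 * 3 by norm_num, matrix_apply_mul_of_coprime (by norm_num) i j, matrix_two, matrix_three]
  norm_num

/-- **`T(4)_ij = 7`** (`2·T(4) = r₁₃(4) = 14`). [cite: Eichler1973, Ch. II §6 Thm. 2 (19) and Cor. 1] -/
theorem matrix_four (i j : ClassSet (Submodule.span ℤ (Set.range ![(⟨1, 0, 0, 0⟩ : ℍ[ℚ,-2,-13]), ⟨0, 1, 0, 0⟩, ⟨1/2, 1/2, 1/2, 0⟩, ⟨-1/2, 1/4, 0, 1/4⟩]))) : matrix (Submodule.span ℤ (Set.range ![(⟨1, 0, 0, 0⟩ : ℍ[ℚ,-2,-13]), ⟨0, 1, 0, 0⟩, ⟨1/2, 1/2, 1/2, 0⟩, ⟨-1/2, 1/4, 0, 1/4⟩])) 4 i j = 7 := by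
  have h := matrix_apply_of_natCard_form (n := 4) (s := 14) (by norm_num) (by exact_mod_cast natCard_form_four) i j
  omega

/-- **`T(8)_ij = 15`** (`2·T(8) = r₁₃(8) = 30`). [cite: Eichler1973, Ch. II §6 Thm. 2 (19) and Cor. 1] -/
theorem matrix_eight (i j : ClassSet (Submodule.span ℤ (Set.range ![(⟨1, 0, 0, 0⟩ : ℍ[ℚ,-2,-13]), ⟨0, 1, 0, 0⟩, ⟨1/2, 1/2, 1/2, 0⟩, ⟨-1/2, 1/4, 0, 1/4⟩]))) : matrix (Submodule.span ℤ (Set.range ![(⟨1, 0, 0, 0⟩ : ℍ[ℚ,-2,-13]), ⟨0, 1, 0, 0⟩, ⟨1/2, 1/2, 1/2, 0⟩, ⟨-1/2, 1/4, 0, 1/4⟩])) 8 i j = 15 := by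
  have h := matrix_apply_of_natCard_form (n := 8) (s := 30) (by norm_num) (by exact_mod_cast natCard_form_eight) i j
  omega

/-- **`T(9)_ij = 13`** (`2·T(9) = r₁₃(9) = 26`). [cite: Eichler1973, Ch. II §6 Thm. 2 (19) and Cor. 1] -/
theorem matrix_nine (i j : ClassSet (Submodule.span ℤ (Set.range ![(⟨1, 0, 0, 0⟩ : ℍ[ℚ,-2,-13]), ⟨0, 1, 0, 0⟩, ⟨1/2, 1/2, 1/2, 0⟩, ⟨-1/2, 1/4, 0, 1/4⟩]))) : matrix (Submodule.span ℤ (Set.range ![(⟨1, 0, 0, 0⟩ : ℍ[ℚ,-2,-13]), ⟨0, 1, 0, 0⟩, ⟨1/2, 1/2, 1/2, 0⟩, ⟨-1/2, 1/4, 0, 1/4⟩])) 9 i j = 13 := by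
  have h := matrix_apply_of_natCard_form (n := 9) (s := 26) (by norm_num) (by exact_mod_cast natCard_form_nine) i j
  omega

/-- **`T(16)_ij = 31`** (`2·T(16) = r₁₃(16) = 62`). [cite: Eichler1973, Ch. II §6 Thm. 2 (19) and Cor. 1] -/
theorem matrix_sixteen (i j : ClassSet (Submodule.span ℤ (Set.range ![(⟨1, 0, 0, 0⟩ : ℍ[ℚ,-2,-13]), ⟨0, 1, 0, 0⟩, ⟨1/2, 1/2, 1/2, 0⟩, ⟨-1/2, 1/4, 0, 1/4⟩]))) : matrix (Submodule.span ℤ (Set.range ![(⟨1, 0, 0, 0⟩ : ℍ[ℚ,-2,-13]), ⟨0, 1, 0, 0⟩, ⟨1/2, 1/2, 1/2, 0⟩, ⟨-1/2, 1/4, 0, 1/4⟩])) 16 i j = 31 := by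
  have h := matrix_apply_of_natCard_form (n := 16) (s := 62) (by norm_num) (by exact_mod_cast natCard_form_sixteen) i j
  omega

/-- **EICHLER'S RECURSION (19) AT `p = 2`, `μ = ν = 1`, FOR `O₁₃`: `B(2)B(2) = B(4) + 2·B(1)`** (`3·3 = 7 + 2`).
[cite: Eichler1973, Ch. II §6 Thm. 2 (19)] [cite: Voight2021, Prop. 41.2.12] -/
theorem matrix_two_mul_matrix_two [Fintype (ClassSet (Submodule.span ℤ (Set.range ![(⟨1, 0, 0, 0⟩ : ℍ[ℚ,-2,-13]), ⟨0, 1, 0, 0⟩, ⟨1/2, 1/2, 1/2, 0⟩, ⟨-1/2, 1/4, 0, 1/4⟩])))] [DecidableEq (ClassSet (Submodule.span ℤ (Set.range ![(⟨1, 0, 0, 0⟩ : ℍ[ℚ,-2,-13]), ⟨0, 1, 0, 0⟩, ⟨1/2, 1/2, 1/2, 0⟩, ⟨-1/2, 1/4, 0, 1/4⟩])))] :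
    matrix (Submodule.span ℤ (Set.range ![(⟨1, 0, 0, 0⟩ : ℍ[ℚ,-2,-13]), ⟨0, 1, 0, 0⟩, ⟨1/2, 1/2, 1/2, 0⟩, ⟨-1/2, 1/4, 0, 1/4⟩])) 2 * matrix (Submodule.span ℤ (Set.range ![(⟨1, 0, 0, 0⟩ : ℍ[ℚ,-2,-13]), ⟨0, 1, 0, 0⟩, ⟨1/2, 1/2, 1/2, 0⟩, ⟨-1/2, 1/4, 0, 1/4⟩])) 2 = matrix (Submodule.span ℤ (Set.range ![(⟨1, 0, 0, 0⟩ : ℍ[ℚ,-2,-13]), ⟨0, 1, 0, 0⟩, ⟨1/2, 1/2, 1/2, 0⟩, ⟨-1/2, 1/4, 0, 1/4⟩])) 4 + 2 • (1 : Matrix (ClassSet (Submodule.span ℤ (Set.range ![(⟨1, 0, 0, 0⟩ : ℍ[ℚ,-2,-13]), ⟨0, 1, 0, 0⟩, ⟨1/2, 1/2, 1/2, 0⟩, ⟨-1/2, 1/4, 0, 1/4⟩]))) (ClassSet (Submodule.span ℤ (Set.range ![(⟨1, 0, 0, 0⟩ : ℍ[ℚ,-2,-13]), ⟨0, 1, 0,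 0⟩, ⟨1/2, 1/2, 1/2, 0⟩, ⟨-1/2, 1/4, 0, 1/4⟩]))) ℤ) := by
  haveI := subsingleton_classSet
  ext i j
  rw [mul_apply_pt, Matrix.add_apply, Matrix.smul_apply, Subsingleton.elim j i, Matrix.one_apply_eq, matrix_two, matrix_four]
  norm_num

/-- **EICHLER'S RECURSION (19) AT `p = 2`, `(μ, ν) = (1, 2)`, FOR `O₁₃`: `B(2)B(4) = B(8) + 2·B(2)`** (`3·7 = 15 + 6`).
[cite: Eichler1973, Ch. II §6 Thm. 2 (19)] [cite: Voight2021, Prop. 41.2.12] -/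
theorem matrix_two_mul_matrix_four [Fintype (ClassSet (Submodule.span ℤ (Set.range ![(⟨1, 0, 0, 0⟩ : ℍ[ℚ,-2,-13]), ⟨0, 1, 0, 0⟩, ⟨1/2, 1/2, 1/2, 0⟩, ⟨-1/2, 1/4, 0, 1/4⟩])))] :
    matrix (Submodule.span ℤ (Set.range ![(⟨1, 0, 0, 0⟩ : ℍ[ℚ,-2,-13]), ⟨0, 1, 0, 0⟩, ⟨1/2, 1/2, 1/2, 0⟩, ⟨-1/2, 1/4, 0, 1/4⟩])) 2 * matrix (Submodule.span ℤ (Set.range ![(⟨1, 0, 0, 0⟩ : ℍ[ℚ,-2,-13]), ⟨0, 1, 0, 0⟩, ⟨1/2, 1/2, 1/2, 0⟩, ⟨-1/2, 1/4, 0, 1/4⟩])) 4 = matrix (Submodule.span ℤ (Set.range ![(⟨1, 0, 0, 0⟩ : ℍ[ℚ,-2,-13]), ⟨0, 1, 0, 0⟩, ⟨1/2, 1/2, 1/2, 0⟩, ⟨-1/2, 1/4, 0, 1/4⟩])) 8 + 2 • matrix (Submodule.span ℤ (Set.range ![(⟨1, 0, 0, 0⟩ : ℍ[ℚ,-2,-13]),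 ⟨0, 1, 0, 0⟩, ⟨1/2, 1/2, 1/2, 0⟩, ⟨-1/2, 1/4, 0, 1/4⟩])) 2 := by
  haveI := subsingleton_classSet
  ext i j
  rw [mul_apply_pt, Matrix.add_apply, Matrix.smul_apply, matrix_two, matrix_four, matrix_eight]
  norm_num

/-- **EICHLER'S RECURSION (19) AT `p = 2`, `(μ, ν) = (1, 3)`, FOR `O₁₃`: `B(2)B(8) = B(16) + 2·B(4)`** (`3·15 = 31 + 14`).
[cite: Eichler1973, Ch. II §6 Thm. 2 (19)] [cite: Voight2021, Prop. 41.2.12] -/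
theorem matrix_two_mul_matrix_eight [Fintype (ClassSet (Submodule.span ℤ (Set.range ![(⟨1, 0, 0, 0⟩ : ℍ[ℚ,-2,-13]), ⟨0, 1, 0, 0⟩, ⟨1/2, 1/2, 1/2, 0⟩, ⟨-1/2, 1/4, 0, 1/4⟩])))] :
    matrix (Submodule.span ℤ (Set.range ![(⟨1, 0, 0, 0⟩ : ℍ[ℚ,-2,-13]), ⟨0, 1, 0, 0⟩, ⟨1/2, 1/2, 1/2, 0⟩, ⟨-1/2, 1/4, 0, 1/4⟩])) 2 * matrix (Submodule.span ℤ (Set.range ![(⟨1, 0, 0, 0⟩ : ℍ[ℚ,-2,-13]), ⟨0, 1, 0, 0⟩, ⟨1/2, 1/2, 1/2, 0⟩, ⟨-1/2, 1/4, 0, 1/4⟩])) 8 = matrix (Submodule.span ℤ (Set.range ![(⟨1, 0, 0, 0⟩ : ℍ[ℚ,-2,-13]), ⟨0, 1, 0, 0⟩, ⟨1/2, 1/2, 1/2, 0⟩, ⟨-1/2, 1/4, 0, 1/4⟩])) 16 + 2 • matrix (Submodule.span ℤ (Set.range ![(⟨1, 0, 0, 0⟩ : ℍ[ℚ,-2,-13]),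 ⟨0, 1, 0, 0⟩, ⟨1/2, 1/2, 1/2, 0⟩, ⟨-1/2, 1/4, 0, 1/4⟩])) 4 := by
  haveI := subsingleton_classSet
  ext i j
  rw [mul_apply_pt, Matrix.add_apply, Matrix.smul_apply, matrix_two, matrix_four, matrix_eight, matrix_sixteen]
  norm_num

/-- **EICHLER'S RECURSION (19) AT `p = 3`, `μ = ν = 1`, FOR `O₁₃`: `B(3)B(3) = B(9) + 3·B(1)`** (`4·4 = 13 + 3`).
[cite: Eichler1973, Ch. II §6 Thm. 2 (19)] [cite: Voight2021, Prop. 41.2.12] -/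
theorem matrix_three_mul_matrix_three [Fintype (ClassSet (Submodule.span ℤ (Set.range ![(⟨1, 0, 0, 0⟩ : ℍ[ℚ,-2,-13]), ⟨0, 1, 0, 0⟩, ⟨1/2, 1/2, 1/2, 0⟩, ⟨-1/2, 1/4, 0, 1/4⟩])))] [DecidableEq (ClassSet (Submodule.span ℤ (Set.range ![(⟨1, 0, 0, 0⟩ : ℍ[ℚ,-2,-13]), ⟨0, 1, 0, 0⟩, ⟨1/2, 1/2, 1/2, 0⟩, ⟨-1/2, 1/4, 0, 1/4⟩])))] :
    matrix (Submodule.span ℤ (Set.range ![(⟨1, 0, 0, 0⟩ : ℍ[ℚ,-2,-13]), ⟨0, 1, 0, 0⟩, ⟨1/2, 1/2, 1/2, 0⟩, ⟨-1/2, 1/4, 0, 1/4⟩])) 3 * matrix (Submodule.span ℤ (Set.range ![(⟨1, 0, 0, 0⟩ : ℍ[ℚ,-2,-13]), ⟨0, 1, 0, 0⟩, ⟨1/2, 1/2, 1/2, 0⟩, ⟨-1/2, 1/4, 0, 1/4⟩])) 3 = matrix (Submodule.span ℤ (Set.range ![(⟨1, 0, 0, 0⟩ : ℍ[ℚ,-2,-13]),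 ⟨0, 1, 0, 0⟩, ⟨1/2, 1/2, 1/2, 0⟩, ⟨-1/2, 1/4, 0, 1/4⟩])) 9 + 3 • (1 : Matrix (ClassSet (Submodule.span ℤ (Set.range ![(⟨1, 0, 0, 0⟩ : ℍ[ℚ,-2,-13]), ⟨0, 1, 0, 0⟩, ⟨1/2, 1/2, 1/2, 0⟩, ⟨-1/2, 1/4, 0, 1/4⟩]))) (ClassSet (Submodule.span ℤ (Set.range ![(⟨1, 0, 0, 0⟩ : ℍ[ℚ,-2,-13]), ⟨0, 1, 0, 0⟩, ⟨1/2, 1/2, 1/2, 0⟩, ⟨-1/2, 1/4, 0, 1/4⟩]))) ℤ) := by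
  haveI := subsingleton_classSet
  ext i j
  rw [mul_apply_pt, Matrix.add_apply, Matrix.smul_apply, Subsingleton.elim j i, Matrix.one_apply_eq, matrix_three, matrix_nine]
  norm_num

/-- `T(2ᵃ)_ij = σ(2ᵃ)` for `a ≤ 4` and `T(3ᵃ)_ij = σ(3ᵃ)` for `a ≤ 2` (Eichler Cor. 1: row sums `σ(n)` for `n` prime to `D`; here
the one-point class set). [cite: Eichler1973, Ch. II §6 Thm. 2 Cor. 1] -/
theorem matrix_prime_pow_eq_sigma_small (i j : ClassSet (Submodule.span ℤ (Set.range ![(⟨1, 0, 0, 0⟩ : ℍ[ℚ,-2,-13]), ⟨0, 1, 0, 0⟩, ⟨1/2, 1/2, 1/2, 0⟩, ⟨-1/2, 1/4, 0, 1/4⟩]))) :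
    (∀ {a : ℕ}, a ≤ 4 → matrix (Submodule.span ℤ (Set.range ![(⟨1, 0, 0, 0⟩ : ℍ[ℚ,-2,-13]), ⟨0, 1, 0, 0⟩, ⟨1/2, 1/2, 1/2, 0⟩, ⟨-1/2, 1/4, 0, 1/4⟩])) (2 ^ a) i j = ArithmeticFunction.sigma 1 (2 ^ a)) ∧
      ∀ {a : ℕ}, a ≤ 2 → matrix (Submodule.span ℤ (Set.range ![(⟨1, 0, 0, 0⟩ : ℍ[ℚ,-2,-13]), ⟨0, 1, 0, 0⟩, ⟨1/2, 1/2, 1/2, 0⟩, ⟨-1/2, 1/4, 0, 1/4⟩])) (3 ^ a) i j = ArithmeticFunction.sigma 1 (3 ^ a) := by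
  refine ⟨fun {a} ha => ?_, fun {a} ha => ?_⟩
  · interval_cases a
    · rw [pow_zero, matrix_one' i j, show ArithmeticFunction.sigma 1 1 = 1 by decide +kernel]
      norm_num
    · rw [pow_one, matrix_two, show ArithmeticFunction.sigma 1 2 = 3 by decide +kernel]
      norm_num
    · rw [show (2 : ℕ) ^ 2 = 4 by norm_num, matrix_four, show ArithmeticFunction.sigma 1 4 = 7 by decide +kernel]
      norm_num
    · rw [show (2 : ℕ) ^ 3 = 8 by norm_num, matrix_eight, show ArithmeticFunction.sigma 1 8 = 15 by decide +kernel]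
      norm_num
    · rw [show (2 : ℕ) ^ 4 = 16 by norm_num, matrix_sixteen, show ArithmeticFunction.sigma 1 16 = 31 by decide +kernel]
      norm_num
  · interval_cases a
    · rw [pow_zero, matrix_one' i j, show ArithmeticFunction.sigma 1 1 = 1 by decide +kernel]
      norm_num
    · rw [pow_one, matrix_three, show ArithmeticFunction.sigma 1 3 = 4 by decide +kernel]
      norm_num
    · rw [show (3 : ℕ) ^ 2 = 9 by norm_num, matrix_nine, show ArithmeticFunction.sigma 1 9 = 13 by decide +kernel]
      norm_num

end Hecke

/-! ## §2 In every Brandt setup of type `(1, 13)` -/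

section Setup

/-- The transport of Brandt matrices from `O₁₃` to the Eichler order of any setup of type `(1, 13)` (as in
`MaximalOrderDiscThirteenBrandtSetup`: the algebras are isomorphic, the maximal orders tied by a connecting ideal).
[cite: VignerasLNM800, Ch. III §5 Cor. 5.5 and §5 B] -/
private theorem exists_classSetEquiv_matrix (S : XiSetup 1 13) :
    ∃ ε : ClassSet (Submodule.span ℤ (Set.range ![(⟨1, 0, 0, 0⟩ : ℍ[ℚ,-2,-13]), ⟨0, 1, 0, 0⟩, ⟨1/2, 1/2, 1/2, 0⟩, ⟨-1/2, 1/4, 0, 1/4⟩])) ≃ ClassSet S.O, ∀ n c d, Brandt.matrix S.O n (ε c) (ε d) = Brandt.matrix (Submodule.span ℤ (Set.range ![(⟨1, 0, 0, 0⟩ : ℍ[ℚ,-2,-13]), ⟨0, 1, 0, 0⟩, ⟨1/2, 1/2, 1/2, 0⟩, ⟨-1/2, 1/4, 0, 1/4⟩])) n c d := by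
  haveI := isQuaternionAlgebra
  obtain ⟨e'⟩ := xiSetup_nonempty_algEquiv S
  have e : ℍ[ℚ,-2,-13] ≃+* S.D := e'.symm.toRingEquiv
  obtain ⟨ε₁, -, -, hT₁⟩ := exists_classSetEquiv_map_ringEquiv e (Submodule.span ℤ (Set.range ![(⟨1, 0, 0, 0⟩ : ℍ[ℚ,-2,-13]), ⟨0, 1, 0, 0⟩, ⟨1/2, 1/2, 1/2, 0⟩, ⟨-1/2, 1/4, 0, 1/4⟩]))
  have hdiv : ∀ y : S.D, y ≠ 0 → IsUnit y := fun y hy =>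
    isUnit_of_isTotallyDefinite S.D S.isTotallyDefinite hy
  have hO₁ : Brandt.IsEichlerOrder S.D (((Submodule.span ℤ (Set.range ![(⟨1, 0, 0, 0⟩ : ℍ[ℚ,-2,-13]), ⟨0, 1, 0, 0⟩, ⟨1/2, 1/2, 1/2, 0⟩, ⟨-1/2, 1/4, 0, 1/4⟩]))).map (e.toAddEquiv.toIntLinearEquiv : ℍ[ℚ,-2,-13] →ₗ[ℤ] S.D)) 1 :=
    brandt_isEichlerOrder_one_lattice.map_ringEquiv e
  obtain ⟨I, hI, hIO⟩ := (isEichlerOrder_iff_brandt.mpr hO₁).exists_isInvertibleRightIdeal_leftOrderOf_eq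
    hdiv (isEichlerOrder_iff_brandt.mpr S.isEichlerOrder) one_ne_zero
  have hImem : I ∈ Brandt.rightIdeals (((Submodule.span ℤ (Set.range ![(⟨1, 0, 0, 0⟩ : ℍ[ℚ,-2,-13]), ⟨0, 1, 0, 0⟩, ⟨1/2, 1/2, 1/2, 0⟩, ⟨-1/2, 1/4, 0, 1/4⟩]))).map (e.toAddEquiv.toIntLinearEquiv : ℍ[ℚ,-2,-13] →ₗ[ℤ] S.D)) := by
    rw [rightIdeals_eq_invertibleRightIdeals_of_isTotallyDefinite S.isTotallyDefinite
      (isZOrder_iff_isOrder.mpr hO₁.isOrder)]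
    exact hI
  have hIO' : Brandt.leftOrder I = S.O := hIO
  obtain ⟨ε₂, -, hT₂⟩ :
      ∃ ε₂ : ClassSet (((Submodule.span ℤ (Set.range ![(⟨1, 0, 0, 0⟩ : ℍ[ℚ,-2,-13]), ⟨0, 1, 0, 0⟩, ⟨1/2, 1/2, 1/2, 0⟩, ⟨-1/2, 1/4, 0, 1/4⟩]))).map (e.toAddEquiv.toIntLinearEquiv : ℍ[ℚ,-2,-13] →ₗ[ℤ] S.D)) ≃ ClassSet S.O,
        (∀ c, weight S.O (ε₂ c) = weight (((Submodule.span ℤ (Set.range ![(⟨1, 0, 0, 0⟩ : ℍ[ℚ,-2,-13]), ⟨0, 1, 0, 0⟩, ⟨1/2, 1/2, 1/2, 0⟩, ⟨-1/2, 1/4, 0, 1/4⟩]))).map (e.toAddEquiv.toIntLinearEquiv : ℍ[ℚ,-2,-13] →ₗ[ℤ] S.D)) c) ∧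
        ∀ n c d, Brandt.matrix S.O n (ε₂ c) (ε₂ d) =
          Brandt.matrix (((Submodule.span ℤ (Set.range ![(⟨1, 0, 0, 0⟩ : ℍ[ℚ,-2,-13]), ⟨0, 1, 0, 0⟩, ⟨1/2, 1/2, 1/2, 0⟩, ⟨-1/2, 1/4, 0, 1/4⟩]))).map (e.toAddEquiv.toIntLinearEquiv : ℍ[ℚ,-2,-13] →ₗ[ℤ] S.D)) n c d := by
    rw [← hIO']
    exact exists_classSetEquiv_leftOrder S.isTotallyDefinite hO₁.isOrder hImem
  exact ⟨ε₁.trans ε₂, fun n c d => by rw [Equiv.trans_apply, Equiv.trans_apply, hT₂, hT₁]⟩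

/-- `T(4)_ij = 7` for every setup of type `(1, 13)`. [cite: Eichler1973, Ch. II §6 Thm. 2 (19) and Cor. 1] -/
theorem xiSetup_matrix_four (S : XiSetup 1 13) (i j : ClassSet S.O) : Brandt.matrix S.O 4 i j = 7 := by
  obtain ⟨ε, hT⟩ := exists_classSetEquiv_matrix S
  rw [← ε.apply_symm_apply i, ← ε.apply_symm_apply j, hT, matrix_four]

/-- `T(8)_ij = 15` for every setup of type `(1, 13)`. [cite: Eichler1973, Ch. II §6 Thm. 2 (19) and Cor. 1] -/
theorem xiSetup_matrix_eight (S : XiSetup 1 13) (i j : ClassSet S.O) : Brandt.matrix S.O 8 i j = 15 := by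
  obtain ⟨ε, hT⟩ := exists_classSetEquiv_matrix S
  rw [← ε.apply_symm_apply i, ← ε.apply_symm_apply j, hT, matrix_eight]

/-- `T(9)_ij = 13` for every setup of type `(1, 13)`. [cite: Eichler1973, Ch. II §6 Thm. 2 (19) and Cor. 1] -/
theorem xiSetup_matrix_nine (S : XiSetup 1 13) (i j : ClassSet S.O) : Brandt.matrix S.O 9 i j = 13 := by
  obtain ⟨ε, hT⟩ := exists_classSetEquiv_matrix S
  rw [← ε.apply_symm_apply i, ← ε.apply_symm_apply j, hT, matrix_nine]

/-- `T(16)_ij = 31` for every setup of type `(1, 13)`. [cite: Eichler1973, Ch. II §6 Thm. 2 (19) and Cor. 1] -/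
theorem xiSetup_matrix_sixteen (S : XiSetup 1 13) (i j : ClassSet S.O) : Brandt.matrix S.O 16 i j = 31 := by
  obtain ⟨ε, hT⟩ := exists_classSetEquiv_matrix S
  rw [← ε.apply_symm_apply i, ← ε.apply_symm_apply j, hT, matrix_sixteen]

/-- **Eichler's recursion `B(2)² = B(4) + 2·1` in every Brandt setup of type `(1, 13)`.** [cite: Eichler1973, Ch. II §6 Thm. 2 (19)] [cite: Voight2021, Prop. 41.2.12] -/
theorem xiSetup_matrix_two_mul_matrix_two (S : XiSetup 1 13) [Fintype (ClassSet S.O)] [DecidableEq (ClassSet S.O)] :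
    Brandt.matrix S.O 2 * Brandt.matrix S.O 2 = Brandt.matrix S.O 4 + 2 • (1 : Matrix (ClassSet S.O) (ClassSet S.O) ℤ) := by
  haveI := xiSetup_subsingleton_classSet S
  ext i j
  rw [Matrix.mul_apply, Fintype.sum_subsingleton _ i, Subsingleton.elim j i, Matrix.add_apply, Matrix.smul_apply,
    Matrix.one_apply_eq, xiSetup_matrix_prime S Nat.prime_two (by norm_num), xiSetup_matrix_four]
  norm_num

/-- **Eichler's recursion `B(3)² = B(9) + 3·1` in every Brandt setup of type `(1, 13)`.** [cite: Eichler1973, Ch. II §6 Thm. 2 (19)] [cite: Voight2021, Prop. 41.2.12] -/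
theorem xiSetup_matrix_three_mul_matrix_three (S : XiSetup 1 13) [Fintype (ClassSet S.O)] [DecidableEq (ClassSet S.O)] :
    Brandt.matrix S.O 3 * Brandt.matrix S.O 3 = Brandt.matrix S.O 9 + 3 • (1 : Matrix (ClassSet S.O) (ClassSet S.O) ℤ) := by
  haveI := xiSetup_subsingleton_classSet S
  ext i j
  rw [Matrix.mul_apply, Fintype.sum_subsingleton _ i, Subsingleton.elim j i, Matrix.add_apply, Matrix.smul_apply,
    Matrix.one_apply_eq, xiSetup_matrix_prime S Nat.prime_three (by norm_num), xiSetup_matrix_nine]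
  norm_num

end Setup

end Literature.NumberTheory.Automorphic.MaxOrderDiscThirteen
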